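import Summits.CriticalPhenomena.CardyFormulaZ2.Theorems.CardyUniqueLimitCardyRigidityLoewnerKit
import Summits.CriticalPhenomena.CardyFormulaZ2.Theorems.CardyUniqueLimitCardyRigidityMartingaleOfDataFlow
import Literature.Probability.RandomPlanarGeometry.LoewnerRealFlowDriverContinuity
import HarnessLib

/-!
# Loewner–Carathéodory convergence kit, II: real flows and level boxes under driver convergence

Crux `Summit.CriticalPhenomena.CardyFormulaZ2.Theses.CardyUniqueLimit.CardyRigidity`
(stmt-CriticalPhenomena-0746), line `crossing_martingale`, helper kit for the registered stub A3b
`stub_slitObservableApprox`; sequel of `…LoewnerKit.lean` (maps).  In the vocabulary of the line's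
definitions module (`markFlow W y t ω = Loewner.realFlowStop (W ω) y t`, `etaProc`, `levelTime`,
`crossingObs`, `AdmissibleLevels`) this file provides:

* (L2a) `continuousAt_realFlowStop_prod` — JOINT continuity of `(t, w) ↦ X^y_t(w) = realFlowStop w y t`
  on `ℝ≥0 × C([0,∞), ℝ)` at every `(t₀, w₀)` with `t₀ < T_y(w₀)` (the tree's
  `Loewner.continuousAt_realFlowStop_driver`, its separation hypothesis discharged by compactness),
  and `isOpen_setOf_lt_swallowingTime_prod` — `{(t, w) | t < T_y(w)}` is open (lower
  semicontinuity of the swallowing time of a real point in the driving path; KS Lemma 5.4);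
  `tendstoUniformlyOn_realFlowStop_of_tendstoUniformlyOn_driving` — the uniform-in-time form along
  a filter of drivers converging uniformly on `[0, b]`, `b < T_y`.
* (L2b) THE LEVEL BOX IS CLOSED IN THE LIMIT (`levelBox_limit`): if `(t_k, ξ_k) → (t, ξ)` with
  `t_k ≤ levelTime … ξ_k` (paths started in the window), then all three marks are alive at time `t`
  under the limit path, its mark flows at `t` lie in the CLOSED level box, `η_{t_k}(ξ_k) → η_t(ξ)` and
  `η_t(ξ) ∈ (0,1)` — the semicontinuity the compactness assembly of A3b needs (the level time itself,
  an exit time from OPEN intervals, is only lower semicontinuous: `Process.eventually_coe_lt_exitTime_comp`;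
  the closed-box statement is the usable upper half).  Also `crossingObs_eq_of_le_levelTime`
  (`crossingObs f W x m M d t = f (η_t)` for `t ≤ levelTime`).
(The cross-ratio form of the modulus, L5, is in `…LoewnerKit3.lean`.)

References: Lawler (2005) §4.1, §4.7 (Prop. 4.47); Kemppainen–Smirnov (2017) App. A Lemma 5.4;
Werner (2007) §3; Camia–Newman (2007) §5.
-/

noncomputable section

open Set Filter Topology Metric
open scoped NNReal
open Literature.Probability.RandomPlanarGeometry Literature.Probability.RandomPlanarGeometry.Loewner
open Literature.Probability.Process (exitTime)

namespace Summit.CriticalPhenomena.CardyFormulaZ2.Cruxes.CardyRigidity.CrossingMartingale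

namespace LoewnerKit

/-! ### (L2a) The frozen real flow: joint continuity in time and driving path -/

section RealFlow

/-- Before its swallowing time the frozen flow of a real point stays a definite distance from `0`
on `[0, b]` (continuity and non-vanishing on a compact interval). [folklore] -/
theorem exists_pos_le_abs_realFlowStop {w : ℝ≥0 → ℝ} (hw : Continuous w) {y : ℝ} {b : ℝ≥0}
    (hb : (b : WithTop ℝ≥0) < swallowingTime w y) :
    ∃ m : ℝ≥0, 0 < m ∧ ∀ s : ℝ≥0, s ≤ b → (m : ℝ) ≤ |realFlowStop w y s| := by
  have hy : y ≠ w 0 := by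
    have h := ne_driving_of_lt_swallowingTime (lt_of_le_of_lt bot_le hb : ((0 : ℝ≥0) : WithTop ℝ≥0) < _)
    intro h'; exact h (by rw [h'])
  have hcont : Continuous fun s ↦ |realFlowStop w y s| := (continuous_realFlowStop_of_ne hw hy).abs
  have hne : (Icc (0 : ℝ≥0) b).Nonempty := ⟨0, left_mem_Icc.2 bot_le⟩
  obtain ⟨s₀, hs₀, hmin⟩ := isCompact_Icc.exists_isMinOn hne hcont.continuousOn
  have hpos : 0 < |realFlowStop w y s₀| := by
    have hs₀T : (s₀ : WithTop ℝ≥0) < swallowingTime w y :=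
      lt_of_le_of_lt (WithTop.coe_le_coe.2 hs₀.2) hb
    rcases lt_or_gt_of_ne hy with h | h
    · have := realFlow_neg hw h hs₀T
      rw [← realFlowStop_of_lt hs₀T] at this
      exact abs_pos.2 this.ne
    · have := realFlow_pos hw h hs₀T
      rw [← realFlowStop_of_lt hs₀T] at this
      exact abs_pos.2 this.ne'
  refine ⟨⟨|realFlowStop w y s₀|, abs_nonneg _⟩, hpos, fun s hs ↦ ?_⟩
  exact hmin (show s ∈ Icc (0 : ℝ≥0) b from ⟨bot_le, hs⟩)

/-- **(L2a) Joint continuity of the frozen real flow in time and driving path.**  If the real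
point `y` is alive at time `t₀` under the path `w₀` (`t₀ < T_y(w₀)`), then
`(t, w) ↦ realFlowStop w y t` on `ℝ≥0 × C([0,∞), ℝ)` is continuous at `(t₀, w₀)`
(`Loewner.continuousAt_realFlowStop_driver` on `[0, b]` for a time `b ∈ (t₀, T_y(w₀))`).
[cite: Lawler2005, Ch. 4 §4.7 (Prop. 4.47)] -/
theorem continuousAt_realFlowStop_prod {w₀ : C(ℝ≥0, ℝ)} {y : ℝ} {t₀ : ℝ≥0}
    (h : (t₀ : WithTop ℝ≥0) < swallowingTime w₀ y) :
    ContinuousAt (fun q : ℝ≥0 × C(ℝ≥0, ℝ) ↦ realFlowStop q.2 y q.1) (t₀, w₀) := by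
  obtain ⟨b, ht₀b, hb⟩ := exists_coe_btwn h
  obtain ⟨m, hm, hfar⟩ := exists_pos_le_abs_realFlowStop w₀.continuous hb
  exact continuousAt_realFlowStop_driver hb hm hfar ht₀b

/-- The same read through a continuous map `Φ : X → C([0,∞), ℝ)` and a continuous clock
`τ : X → ℝ≥0`: `ξ ↦ realFlowStop (Φ ξ) y (τ ξ)` is continuous at `ξ₀` when `τ ξ₀ < T_y(Φ ξ₀)`.
[cite: Lawler2005, Ch. 4 §4.7 (Prop. 4.47)] -/
theorem continuousAt_realFlowStop_comp {X : Type*} [TopologicalSpace X] {Φ : X → C(ℝ≥0, ℝ)}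
    {τ : X → ℝ≥0} {ξ₀ : X} (hΦ : ContinuousAt Φ ξ₀) (hτ : ContinuousAt τ ξ₀) {y : ℝ}
    (h : (τ ξ₀ : WithTop ℝ≥0) < swallowingTime (Φ ξ₀) y) :
    ContinuousAt (fun ξ ↦ realFlowStop (Φ ξ) y (τ ξ)) ξ₀ :=
  ContinuousAt.comp (f := fun ξ ↦ (τ ξ, Φ ξ)) (g := fun q : ℝ≥0 × C(ℝ≥0, ℝ) ↦ realFlowStop q.2 y q.1)
    (continuousAt_realFlowStop_prod h) (hτ.prodMk hΦ)

/-- **(L2a) Lower semicontinuity of the swallowing time of a real point in `(t, w)`**: the set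
`{(t, w) | t < T_y(w)}` is open in `ℝ≥0 × C([0,∞), ℝ)` (Kemppainen–Smirnov's Lemma 5.4: a point
alive at time `b` stays alive under uniformly close drivers). [cite: KemppainenSmirnov2017, App. A, Lemma 5.4] -/
theorem isOpen_setOf_lt_swallowingTime_prod (y : ℝ) :
    IsOpen {q : ℝ≥0 × C(ℝ≥0, ℝ) | (q.1 : WithTop ℝ≥0) < swallowingTime q.2 y} := by
  refine isOpen_iff_mem_nhds.2 fun q₀ hq₀ ↦ ?_
  have h := (tendstoUniformlyOn_map_nhds q₀ (isCompact_singleton (x := (y : ℂ)))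
    (fun z hz ↦ by rw [mem_singleton_iff.1 hz]; exact hq₀)).1
  filter_upwards [h] with q hq
  exact hq _ (mem_singleton _)

/-- **(L2a, filter form) Uniform convergence of the frozen real flows on `[0, b]`** along drivers
converging uniformly on `[0, b]`, for a real point alive at time `b` under the limit driver
(the tube estimate `Loewner.abs_realFlowStop_sub_le_of_driving_close`).
[cite: Lawler2005, Ch. 4 §4.7 (Prop. 4.47)] -/
theorem tendstoUniformlyOn_realFlowStop_of_tendstoUniformlyOn_driving {ι : Type*} {l : Filter ι}
    {Wn : ι → ℝ≥0 → ℝ} {W : ℝ≥0 → ℝ} (hW : Continuous W) (hWn : ∀ᶠ n in l, Continuous (Wn n))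
    {b : ℝ≥0} (hconv : TendstoUniformlyOn (fun n (s : ℝ≥0) ↦ Wn n s) W l (Iic b)) {y : ℝ}
    (hb : (b : WithTop ℝ≥0) < swallowingTime W y) :
    (∀ᶠ n in l, (b : WithTop ℝ≥0) < swallowingTime (Wn n) y) ∧
      TendstoUniformlyOn (fun n (s : ℝ≥0) ↦ realFlowStop (Wn n) y s) (realFlowStop W y) l (Iic b) := by
  obtain ⟨m, hm, hfar⟩ := exists_pos_le_abs_realFlowStop hW hb
  have hm' : (0 : ℝ) < m := hm
  set E : ℝ := Real.exp (2 / ((m : ℝ) / 2) ^ 2 * b) with hE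
  have hE1 : 1 ≤ E := Real.one_le_exp (by positivity)
  -- the good indices for a tolerance `ω`
  have hgood : ∀ ω : ℝ, 0 < ω → ω ≤ m / 4 → ω * (E - 1) < m / 4 →
      ∀ᶠ n in l, (b : WithTop ℝ≥0) < swallowingTime (Wn n) y ∧
        ∀ s : ℝ≥0, s ≤ b → |realFlowStop (Wn n) y s - realFlowStop W y s| ≤ ω * E := by
    intro ω hω0 hωm hωE
    filter_upwards [hWn, (Metric.tendstoUniformlyOn_iff.1 hconv) ω hω0] with n hn hn'
    have hclose : ∀ s : ℝ≥0, s ≤ b → |W s - Wn n s| ≤ ω := fun s hs ↦ by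
      have := hn' s hs; rw [Real.dist_eq] at this; exact this.le
    obtain ⟨halive, hest⟩ := abs_realFlowStop_sub_le_of_driving_close hW hn hb hm hfar hω0.le hωm
      hclose hωE
    refine ⟨halive, fun s hs ↦ (hest s hs).trans ?_⟩
    gcongr
    rw [hE]
    exact Real.exp_le_exp.2 (mul_le_mul_of_nonneg_left (NNReal.coe_le_coe.2 hs) (by positivity))
  have hω₁ : (m : ℝ) / 8 / E ≤ m / 4 := by
    calc (m : ℝ) / 8 / E ≤ m / 8 := div_le_self (by positivity) hE1
      _ ≤ m / 4 := by linarith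
  have hω₂ : (m : ℝ) / 8 / E * (E - 1) < m / 4 := by
    have h1 : (m : ℝ) / 8 / E * (E - 1) ≤ m / 8 / E * E :=
      mul_le_mul_of_nonneg_left (by linarith) (by positivity)
    have h2 : (m : ℝ) / 8 / E * E = m / 8 := by field_simp
    linarith
  refine ⟨(hgood _ (by positivity) hω₁ hω₂).mono fun n hn ↦ hn.1, ?_⟩
  rw [Metric.tendstoUniformlyOn_iff]
  intro ε hε
  set ω : ℝ := min ((m : ℝ) / 8 / E) (ε / 2 / E) with hω
  have hω0 : 0 < ω := lt_min (by positivity) (by positivity)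
  have hωle : ω ≤ m / 8 / E := min_le_left _ _
  have hωE : ω * E ≤ ε / 2 := by
    calc ω * E ≤ ε / 2 / E * E := mul_le_mul_of_nonneg_right (min_le_right _ _) (by positivity)
      _ = ε / 2 := by field_simp
  filter_upwards [hgood ω hω0 (hωle.trans hω₁)
    (lt_of_le_of_lt (mul_le_mul_of_nonneg_right hωle (by linarith)) hω₂)] with n hn
  intro s hs
  rw [Real.dist_eq, abs_sub_comm]
  exact lt_of_le_of_lt ((hn.2 s hs).trans hωE) (half_lt_self hε)

end RealFlow

/-! ### (L2b) The level box: marks alive, the observable before the level time, closedness in the limit -/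

section LevelBox

variable {x : Fin 3 → ℝ} {m M d : ℝ}

/-- **Before the level time all three marks are alive** (path started in the window
`x₀ - M < W 0 < x₀ - m`): the mark flows are `≥ m > 0` there, and a frozen flow vanishes from
the swallowing time on. [cite: Werner2007, §3] -/
theorem lt_swallowingTime_marks_of_le_levelTime {Ω : Type*} {W : Ω → ℝ≥0 → ℝ} {ω : Ω}
    (hc : Continuous (W ω)) (h : AdmissibleLevels x m M d) (hw : W ω 0 ∈ Ioo (x 0 - M) (x 0 - m))
    {τ : ℝ≥0} (hτ : (τ : WithTop ℝ≥0) ≤ levelTime W x m M d ω) (i : Fin 3) :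
    (τ : WithTop ℝ≥0) < swallowingTime (W ω) (x i) := by
  obtain ⟨h0, h01, h12⟩ := MartingaleOfData.marks_pos_pt hc h hw hτ
  have hpos : 0 < markFlow W (x i) τ ω := by
    fin_cases i
    · exact h0
    · exact h0.trans h01
    · exact (h0.trans h01).trans h12
  exact coe_lt_swallowingTime_of_realFlowStop_ne_zero hpos.ne'

/-- **The level-stopped observable before the level time is `f(η_t)`.** [folklore] -/
theorem crossingObs_eq_of_le_levelTime {Ω : Type*} {W : Ω → ℝ≥0 → ℝ} {ω : Ω} (f : ℝ → ℝ)
    {t : ℝ≥0} (ht : (t : WithTop ℝ≥0) ≤ levelTime W x m M d ω) :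
    crossingObs f W x m M d t ω = f (etaProc W x t ω) := by
  simp only [crossingObs]
  rw [MeasureTheory.stoppedProcess_eq_of_le ht]

/-- Before the level time the modulus lies in `(0, 1)` (path started in the window).
[cite: Werner2007, §3] -/
theorem etaProc_mem_Ioo_of_le_levelTime {Ω : Type*} {W : Ω → ℝ≥0 → ℝ} {ω : Ω}
    (hc : Continuous (W ω)) (h : AdmissibleLevels x m M d) (hw : W ω 0 ∈ Ioo (x 0 - M) (x 0 - m))
    {τ : ℝ≥0} (hτ : (τ : WithTop ℝ≥0) ≤ levelTime W x m M d ω) :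
    etaProc W x τ ω ∈ Ioo (0 : ℝ) 1 := by
  obtain ⟨h0, h01, h12⟩ := MartingaleOfData.marks_pos_pt hc h hw hτ
  exact cardyEta_mem_Ioo h0 h01 h12

/-- A time just before `c > 0` within a prescribed distance. [folklore] -/
theorem exists_lt_dist_lt {c : ℝ≥0} (hc : 0 < c) {δ : ℝ} (hδ : 0 < δ) :
    ∃ s : ℝ≥0, s < c ∧ dist s c < δ := by
  obtain ⟨s, hs₁, hs₂⟩ := exists_between (show max (0 : ℝ) (c - δ / 2) < c from
    max_lt (NNReal.coe_pos.2 hc) (by linarith))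
  have hs0 : 0 ≤ s := (le_max_left _ _).trans hs₁.le
  refine ⟨⟨s, hs0⟩, by exact_mod_cast hs₂, ?_⟩
  rw [NNReal.dist_eq]
  show |s - (c : ℝ)| < δ
  rw [abs_sub_comm, abs_of_pos (by linarith)]
  have := (le_max_right _ _).trans_lt hs₁
  linarith

/-- The mark flows of path space read as frozen real flows (`markFlow eval y s w = X^y_s(w)`).
[folklore] -/
theorem markFlow_eval (y : ℝ) (s : ℝ≥0) (w : C(ℝ≥0, ℝ)) :
    markFlow (fun (w : C(ℝ≥0, ℝ)) (r : ℝ≥0) ↦ w r) y s w = realFlowStop w y s := rfl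

/-- **(L2b) The level box is closed in the limit — the semicontinuity the compactness assembly
needs.**  On driving-path space (`W = eval`, as in `PercSlitObservableApprox`), let paths `w_k → w`
locally uniformly and times `t_k → t` along a filter, with (eventually) `w_k` started in the window
`x₀ - M < w_k 0 < x₀ - m` and `t_k ≤ levelTime … w_k`.  Then under the LIMIT path all three marks
are alive at time `t`, the mark flows at `t` lie in the CLOSED level box `[m, M] × [d, x₂-x₀+1]²`,
the moduli converge, `η_{t_k}(w_k) → η_t(w)`, and `η_t(w) ∈ (0, 1)`.  (The level time itself — an
exit time from open intervals — is only lower semicontinuous; this closed-box statement is its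
usable upper half.  Key step: if the first mark were swallowed by time `t` under `w`, its flow
would be `< m/2` at some earlier alive time `s`, where the flows of the `w_k` converge to it while
being `≥ m`.) [cite: CamiaNewman2007, §5] [cite: Lawler2005, Ch. 4 §4.7 (Prop. 4.47)] -/
theorem levelBox_limit {ι : Type*} {l : Filter ι} [l.NeBot] (h : AdmissibleLevels x m M d)
    {wk : ι → C(ℝ≥0, ℝ)} {w : C(ℝ≥0, ℝ)} {tk : ι → ℝ≥0} {t : ℝ≥0}
    (hw : Tendsto wk l (𝓝 w)) (ht : Tendsto tk l (𝓝 t))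
    (hwin : ∀ᶠ k in l, wk k 0 ∈ Ioo (x 0 - M) (x 0 - m))
    (hlev : ∀ᶠ k in l, (tk k : WithTop ℝ≥0) ≤
      levelTime (fun (w : C(ℝ≥0, ℝ)) (r : ℝ≥0) ↦ w r) x m M d (wk k)) :
    (∀ i, (t : WithTop ℝ≥0) < swallowingTime w (x i)) ∧
    markFlow (fun (w : C(ℝ≥0, ℝ)) (r : ℝ≥0) ↦ w r) (x 0) t w ∈ Icc m M ∧
    markFlow (fun (w : C(ℝ≥0, ℝ)) (r : ℝ≥0) ↦ w r) (x 1) t w -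
      markFlow (fun (w : C(ℝ≥0, ℝ)) (r : ℝ≥0) ↦ w r) (x 0) t w ∈ Icc d (x 2 - x 0 + 1) ∧
    markFlow (fun (w : C(ℝ≥0, ℝ)) (r : ℝ≥0) ↦ w r) (x 2) t w -
      markFlow (fun (w : C(ℝ≥0, ℝ)) (r : ℝ≥0) ↦ w r) (x 1) t w ∈ Icc d (x 2 - x 0 + 1) ∧
    Tendsto (fun k ↦ etaProc (fun (w : C(ℝ≥0, ℝ)) (r : ℝ≥0) ↦ w r) x (tk k) (wk k)) l
      (𝓝 (etaProc (fun (w : C(ℝ≥0, ℝ)) (r : ℝ≥0) ↦ w r) x t w)) ∧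
    etaProc (fun (w : C(ℝ≥0, ℝ)) (r : ℝ≥0) ↦ w r) x t w ∈ Ioo (0 : ℝ) 1 := by
  simp only [etaProc, markFlow_eval]
  -- (a) the level boxes along the filter, read as frozen real flows
  have hbox : ∀ᶠ k in l, ∀ s : ℝ≥0, s ≤ tk k →
      realFlowStop (wk k) (x 0) s ∈ Icc m M ∧
      realFlowStop (wk k) (x 1) s - realFlowStop (wk k) (x 0) s ∈ Icc d (x 2 - x 0 + 1) ∧
      realFlowStop (wk k) (x 2) s - realFlowStop (wk k) (x 1) s ∈ Icc d (x 2 - x 0 + 1) := by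
    filter_upwards [hwin, hlev] with k hk hk' s hs
    exact MartingaleOfData.marks_mem_box_pt (W := fun (w : C(ℝ≥0, ℝ)) (r : ℝ≥0) ↦ w r)
      (wk k).continuous h hk ((WithTop.coe_le_coe.2 hs).trans hk')
  -- (0) the limit path starts below `x₀ - m`
  have hstart : w 0 ≤ x 0 - m := by
    have hev : Tendsto (fun k ↦ wk k 0) l (𝓝 (w 0)) :=
      ((continuous_eval_const (F := C(ℝ≥0, ℝ)) (0 : ℝ≥0)).tendsto w).comp hw
    exact le_of_tendsto hev (hwin.mono fun k hk ↦ hk.2.le)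
  have hx0 : w 0 < x 0 := by linarith [h.m_pos]
  -- the joint limit of a frozen flow along `(τ_k, w_k) → (τ, w)` at an alive time `τ`
  have hjoint : ∀ {y : ℝ} {τk : ι → ℝ≥0} {τ : ℝ≥0}, (τ : WithTop ℝ≥0) < swallowingTime w y →
      Tendsto τk l (𝓝 τ) →
      Tendsto (fun k ↦ realFlowStop (wk k) y (τk k)) l (𝓝 (realFlowStop w y τ)) := by
    intro y τk τ hτ hτk
    have hcv : Tendsto ((fun q : ℝ≥0 × C(ℝ≥0, ℝ) ↦ realFlowStop q.2 y q.1) ∘ fun k ↦ (τk k, wk k))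
        l (𝓝 (realFlowStop w y τ)) :=
      (continuousAt_realFlowStop_prod hτ).tendsto.comp (hτk.prodMk_nhds hw)
    exact hcv
  -- flows of the `w_k` at a fixed alive time `s` eventually past which the clocks run
  have hflow_at : ∀ {s : ℝ≥0}, (s : WithTop ℝ≥0) < swallowingTime w (x 0) → s < t →
      m ≤ realFlowStop w (x 0) s := by
    intro s hs hst
    refine ge_of_tendsto (hjoint hs tendsto_const_nhds) ?_
    filter_upwards [hbox, ht.eventually (Ioi_mem_nhds hst)] with k hk hk'
    exact (hk s (le_of_lt hk')).1.1
  -- (b) the first mark is alive at time `t` under the limit path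
  have halive0 : (t : WithTop ℝ≥0) < swallowingTime w (x 0) := by
    by_contra hle
    rw [not_lt] at hle
    obtain ⟨c, hc⟩ := WithTop.ne_top_iff_exists.1 (ne_top_of_le_ne_top WithTop.coe_ne_top hle)
    have hct : c ≤ t := by rw [← hc] at hle; exact WithTop.coe_le_coe.1 hle
    have hc0 : 0 < c := by
      have hx0' : ((x 0 : ℝ) : ℂ) ≠ (w 0 : ℝ) := fun h' ↦ hx0.ne' (by exact_mod_cast h')
      have := swallowingTime_pos_holds w.continuous hx0'
      rw [← hc] at this
      exact WithTop.coe_pos.1 this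
    -- the flow of `x₀` under `w` is continuous and vanishes at `c`
    have hX : Continuous (realFlowStop w (x 0)) := continuous_realFlowStop w.continuous hx0
    have hXc : realFlowStop w (x 0) c = 0 := realFlowStop_of_le (by rw [← hc])
    obtain ⟨δ, hδ, hδm⟩ := Metric.continuousAt_iff.1 (hX.continuousAt (x := c)) (m / 2)
      (half_pos h.m_pos)
    obtain ⟨s, hsc, hsδ⟩ := exists_lt_dist_lt hc0 hδ
    have hs : (s : WithTop ℝ≥0) < swallowingTime w (x 0) := by
      rw [← hc]; exact WithTop.coe_lt_coe.2 hsc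
    have h1 := hflow_at hs (hsc.trans_le hct)
    have h2 := hδm hsδ
    rw [hXc, Real.dist_eq, sub_zero] at h2
    linarith [le_abs_self (realFlowStop w (x 0) s), h.m_pos]
  have halive : ∀ i, (t : WithTop ℝ≥0) < swallowingTime w (x i) := fun i ↦
    lt_of_lt_of_le halive0 (swallowingTime_mono_right w.continuous hx0
      (h.strictMono.monotone (Fin.zero_le i)))
  -- (d) convergence of the three mark flows at `(t_k, w_k) → (t, w)`
  have hflow : ∀ i, Tendsto (fun k ↦ realFlowStop (wk k) (x i) (tk k)) l
      (𝓝 (realFlowStop w (x i) t)) := fun i ↦ hjoint (halive i) ht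
  -- (e) the closed box
  have hB0 : realFlowStop w (x 0) t ∈ Icc m M :=
    isClosed_Icc.mem_of_tendsto (hflow 0) (hbox.mono fun k hk ↦ (hk (tk k) le_rfl).1)
  have hB1 : realFlowStop w (x 1) t - realFlowStop w (x 0) t ∈ Icc d (x 2 - x 0 + 1) :=
    isClosed_Icc.mem_of_tendsto ((hflow 1).sub (hflow 0))
      (hbox.mono fun k hk ↦ (hk (tk k) le_rfl).2.1)
  have hB2 : realFlowStop w (x 2) t - realFlowStop w (x 1) t ∈ Icc d (x 2 - x 0 + 1) :=
    isClosed_Icc.mem_of_tendsto ((hflow 2).sub (hflow 1))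
      (hbox.mono fun k hk ↦ (hk (tk k) le_rfl).2.2)
  -- (f), (g) the modulus
  have hp0 : 0 < realFlowStop w (x 0) t := h.m_pos.trans_le hB0.1
  have hp01 : realFlowStop w (x 0) t < realFlowStop w (x 1) t := by linarith [hB1.1, h.d_pos]
  have hp12 : realFlowStop w (x 1) t < realFlowStop w (x 2) t := by linarith [hB2.1, h.d_pos]
  have hden : realFlowStop w (x 1) t * (realFlowStop w (x 2) t - realFlowStop w (x 0) t) ≠ 0 := by
    have h1 : 0 < realFlowStop w (x 1) t := hp0.trans hp01
    have h2 : 0 < realFlowStop w (x 2) t - realFlowStop w (x 0) t := by linarith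
    exact (mul_pos h1 h2).ne'
  refine ⟨halive, hB0, hB1, hB2, ?_, cardyEta_mem_Ioo hp0 hp01 hp12⟩
  simp only [cardyEta]
  exact ((hflow 0).mul ((hflow 2).sub (hflow 1))).div ((hflow 1).mul ((hflow 2).sub (hflow 0)))
    hden

/-- **(L2b, corollary) The observables converge in the limit of the level box**: under the
hypotheses of `levelBox_limit` and for a kernel `f` continuous on `(0,1)`,
`f(η_{t_k}(w_k)) → f(η_t(w))`; before the level times these are the level-stopped observables
(`crossingObs_eq_of_le_levelTime`). [cite: CamiaNewman2007, §5] -/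
theorem tendsto_kernel_etaProc_of_levelBox {ι : Type*} {l : Filter ι} [l.NeBot]
    (h : AdmissibleLevels x m M d) {f : ℝ → ℝ} (hf : ContinuousOn f (Ioo 0 1))
    {wk : ι → C(ℝ≥0, ℝ)} {w : C(ℝ≥0, ℝ)} {tk : ι → ℝ≥0} {t : ℝ≥0}
    (hw : Tendsto wk l (𝓝 w)) (ht : Tendsto tk l (𝓝 t))
    (hwin : ∀ᶠ k in l, wk k 0 ∈ Ioo (x 0 - M) (x 0 - m))
    (hlev : ∀ᶠ k in l, (tk k : WithTop ℝ≥0) ≤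
      levelTime (fun (w : C(ℝ≥0, ℝ)) (r : ℝ≥0) ↦ w r) x m M d (wk k)) :
    Tendsto (fun k ↦ crossingObs f (fun (w : C(ℝ≥0, ℝ)) (r : ℝ≥0) ↦ w r) x m M d (tk k) (wk k)) l
      (𝓝 (f (etaProc (fun (w : C(ℝ≥0, ℝ)) (r : ℝ≥0) ↦ w r) x t w))) := by
  obtain ⟨-, -, -, -, hη, hηI⟩ := levelBox_limit h hw ht hwin hlev
  have hfc : ContinuousAt f (etaProc (fun (w : C(ℝ≥0, ℝ)) (r : ℝ≥0) ↦ w r) x t w) :=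
    hf.continuousAt (isOpen_Ioo.mem_nhds hηI)
  refine (hfc.tendsto.comp hη).congr' ?_
  filter_upwards [hlev] with k hk
  exact (crossingObs_eq_of_le_levelTime f hk).symm

end LevelBox

end LoewnerKit

/-- **Registered form** (anchor `loewnerKit_levelBox_limit` of stmt-CriticalPhenomena-0746): the level box is closed in the
limit along sequences of driving paths converging locally uniformly with clocks below their level times — the marks of
the limit path are alive, the moduli converge and the limit modulus lies in `(0,1)`. [cite: CamiaNewman2007, §5] -/
theorem loewnerKit_levelBox_limit : ∀ {x : Fin 3 → ℝ} {m M d : ℝ}, AdmissibleLevels x m M d → ∀ {wk : ℕ → ContinuousMap NNReal ℝ} {w : ContinuousMap NNReal ℝ} {tk : ℕ → NNReal} {t : NNReal}, Filter.Tendsto wk Filter.atTop (nhds w) → Filter.Tendsto tk Filter.atTop (nhds t) → (∀ᶠ k in Filter.atTop, wk k 0 ∈ Set.Ioo (x 0 - M) (x 0 - m)) → (∀ᶠ k in Filter.atTop, (tk k : WithTop NNReal) ≤ levelTime (fun (w : ContinuousMap NNReal ℝ) (r : NNReal) ↦ w r) x m M d (wk k)) → (∀ i, (t : WithTop NNReal)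 < Literature.Probability.RandomPlanarGeometry.Loewner.swallowingTime (⇑w) (x i)) ∧ Filter.Tendsto (fun k ↦ etaProc (fun (w : ContinuousMap NNReal ℝ) (r : NNReal) ↦ w r) x (tk k) (wk k)) Filter.atTop (nhds (etaProc (fun (w : ContinuousMap NNReal ℝ) (r : NNReal) ↦ w r) x t w)) ∧ etaProc (fun (w : ContinuousMap NNReal ℝ) (r : NNReal) ↦ w r) x t w ∈ Set.Ioo (0 : ℝ) 1 :=
  fun h _ _ _ _ hw ht hwin hlev ↦
    let H := LoewnerKit.levelBox_limit h hw ht hwin hlev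
    ⟨H.1, H.2.2.2.2.1, H.2.2.2.2.2⟩

end Summit.CriticalPhenomena.CardyFormulaZ2.Cruxes.CardyRigidity.CrossingMartingale

end
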